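import Summits.QuantumFields.YangMills.Theorems.FluctuationComparisonRegPrIntLS1aEMLFibreImageNull
import Summits.QuantumFields.YangMills.Theorems.FluctuationComparisonRegPrIntLS1aSliceNullOfBiEquivariant
import Literature.MathematicalPhysics.QuantumFieldTheory.Balaban1983to89.B12RTGaugeInvariance254
import Literature.MathematicalPhysics.QuantumFieldTheory.Balaban1983to89.TorusGeometry
import HarnessLib

/-!
# `FluctuationComparisonRegPrIntLS1aEMLBoundarySliceNull` — (F4-b) OF px17 g21's ROAD TO S1aᴴ (c) AT THE ANCHOR HEIGHTS: THE EML-BRANCH BOUNDARY SET OF ONE (0.4) STEP IS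
# `dU`-NULL OVER EVERY COARSE VALUE — for every coarse bond `c`, radius `r ≠ 0`, ANY extension `E` of the printed `exp[mean log]` off the `1∕2`-guard and EVERY `v ∈ SU(2)`:
# `dU {U | ∃ W, (∀ i, dist1 (fibreFamily U c W i) < 1∕2) ∧ (∃ i, dist1 (fibreFamily U c W i) = r) ∧ E (fibreFamily U c W) · W = v} = 0`

Cell `ym3-torus` (HUMAN RULING D-0037: rung R3 = continuum SU(2) Yang–Mills on T³ — a RUNG: NOT d = 4, NOT infinite volume, NOT a mass gap, NOT Clay), WIDTH COPY «width 20»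
of ym3-torus-p1, seat `ym3-torus-px20` gen 22; `--kind proof --supports stmt-QuantumFields-20520 --as helper` (count-neutral).  THEOREMS ONLY (0 `def`, 0 `sorry`, 0 `instance`,
0 `notation`, default heartbeats, `autoImplicit false`).  FILE 2 of 2 (FILE 1 = ✓`…S1aEMLFibreImageNull`: Lemma A′ on `SU(2)` + the one-environment slice).  Interface = px17 g21
13:14:32Z «(F4) px20 — GO, YOURS» (letters `P : Params`, `j`, `hj : j + 1 ≤ P.m + P.K`, `dU = fieldMeasure P j SU(2)`, lit ✓`BlockAveragingEMLHaarAC.fibreFamily`, `dist1`,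
`ExpMeanLog.eml`, an arbitrary `E : (Idx P → SU(2)) → SU(2)` with `hE : ∀ W, (∀ i, ‖↑(W i) − 1‖ < 1∕2) → ↑(E W) = eml (↑W)`); consumer = px17's (F5) cell assembly («one uncut
(0.4) step preserves everywhere-continuity of densities»), with ✓p823727 `…S1aSliceNullOfBiEquivariant` (F1) as the engine and ✓p822129
`…S1aGuardSphereNull.fieldMeasure_setOf_exists_dist1_fibreFamily_eq_delta_eq_zero` the identity branch (cited, not restated).

WHY (UV3-NODE §67.3 (c) ∕ §77.5 (R2)-EML ∕ px17 g21 12:58:11Z (3)–(4)).  Reading the UNCUT transform `(avgFun ℰp)_*` of an everywhere-continuous density for CONTINUITY over a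
coarse value `y` splits the fine space into guard cells; on the EML cell at `c` the sharp density `ρ·1_{C_α}` jumps across `∂C_α ⊆ ∪_{c,i} {dist1 (loopHol U c i) = δ}`, and the
a.e.-on-the-fibre submersion engine (px17's (F2)) needs, FOR EVERY `y` (not a.e.), that the fibre over `y` meets that jump locus in a null set of the non-private coordinates.  In the
private coordinate `W = U′(c)` of lit ✓`BlockAveragingEMLHaarAC` §1 this is exactly the statement typed here.  ROAD = ENDPOINT-GAUGE TRANSITIVITY: the graph `S = {(U, v) | …}` has
Haar-null VERTICAL slices (FILE 1), is CLOSED at every closed guard radius `ρ < 1∕2` (continuous image of a compact set), and is stable under the one-site gauge transformations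
`u_g = (g at emb c₋, 1 elsewhere)` — `dU`-preserving on `U`, `v ↦ g·v` on the coarse value, TRANSITIVE — so by (F1) EVERY horizontal slice is `dU`-null; the open-guard statement
is the countable union over `ρ_n = 1∕2 − 1∕(n+1)`.  No transversality, no fold analysis, no injectivity of any differential, no smallness; uniform in `L`.

CONTENT (all [folklore] measure theory over Mathlib + tree modules; nothing of Bałaban's analysis).
* §3 THE JOINT GRAPH AT A CLOSED RADIUS `ρ < 1∕2`: `continuousOn_extension` (`E` is continuous on the open `1∕2`-guard, where it IS `eml`); `emb_src_ne_emb_tgt` (lit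
  ✓`TorusGeometry`: `Site.blockOf_emb`, `Params.one_lt_sitesPerDir`); `openHol_gaugeAct_update` (`V_i(u_g • U) = g · V_i(U)`: lit ✓`T4Continuum.holAt_gaugeAct_walk`, the open word
  ends at `emb c₊ ≠ emb c₋`); `fibreFamily_gaugeAct_update` (the W-family at `g·W` is CONJUGATED by `g`); `extension_conj` (lit ✓`ExpMeanLog.eml_conj` through `hE`);
  ★★`isClosed_jointGraph`; ★★★`fieldMeasure_setOf_exists_boundary_preimage_eq_zero_of_le` — the closed-radius slice statement for EVERY `v`, by ✓p823727
  `measure_setOf_eq_zero_of_transitive` with `μ = dU`, `ν = Haar_{SU(2)}`, `φ_g = gaugeAct u_g` (lit ✓`B12RTGaugeInvariance254.measurePreserving_gaugeAct`), `ψ_g v = g·v`.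
* §4 ★★★`fieldMeasure_setOf_exists_boundary_preimage_eq_zero` — (F4-b) VERBATIM (open `1∕2`-guard, any `r ≠ 0`); ★★`…_deltaSU` — at the printed guard radius `r = δ_{SU(2)}`
  (lit ✓`ExpMeanLog.deltaSU`).

AS PRINTED vs AS TYPED (★p1).  Print integrates the formula (0.4) «for configurations close to the identity» ([Balaban1987RG1] p. 253) and never meets a guard; the tree's TOTAL
guarded `corr` creates the jump locus, and S1aᴴ's own (c) conjunct («`ContinuousOn ρ_j {PlaqSmall θ_j}`» at the UNCUT anchor heights) is what asks for it to be invisible fibrewise.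
This file is the EML-branch half of that bookkeeping; the identity branch is ✓p822129; the Jacobian face (F3′), the cell assembly (F5) and the S1aᴴ plug (F6) are px17 g21's.

HONEST FRAMING.  [folklore] measure theory; nothing of Bałaban's renormalisation-group analysis is asserted or proved; `hE` is a HYPOTHESIS on the extension `E` ((F3′) supplies
`∃ E`); S1aᴴ (c) is NOT closed by this file; S1a(ᴴ) (m) AS TYPED misstated by currency (RULING №80) ∕ AS PRINTED OPEN; the five registered stubs of
`Lines/semiclassical_s2beta.lean` (3732b7df, untouched), crux 20520 ∕ 19936 ∕ 19200 and `YM3TorusSU2` are NOT proved; registry untouched; rung R3 = SU(2) YM₃ on T³ at fixed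
lattice data — NOT d = 4, NOT infinite volume, NOT a mass gap, NOT Clay; the Yang–Mills mass gap is NOT proved by any of this.
References: [Balaban1987RG1] T. Bałaban, CMP **109** (1987) 249–301, (0.4)–(0.6) p. 253; [Balaban1985Averaging] CMP **98** (1985) 17–51, (8)–(10) pp. 18–19.
-/

set_option autoImplicit false

noncomputable section

open MeasureTheory Set Function Filter Topology
open scoped ENNReal Matrix.Norms.L2Operator

namespace Summit.QuantumFields.YangMills.Theorems.FluctuationComparisonRegPrIntLS1aEMLBoundarySliceNull

open Summit.QuantumFields.YangMills.Theorems.FluctuationComparisonRegPrIntLS1aEMLFibreImageNull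

/-! ## §3 The joint boundary graph over `GaugeField × SU(2)` at a CLOSED guard radius: closed, slice-null, gauge-stable -/

section Joint

open Literature.MathematicalPhysics.QuantumFieldTheory.Balaban1983to89
open T4Continuum BlockAveraging BlockAveragingHaarAC BlockAveragingEMLHaarAC
open ExpMeanLog (eml analyticAt_eml eml_conj)
open Summit.QuantumFields.YangMills.Theorems.FluctuationComparisonRegPrIntLS1aSliceNullOfBiEquivariant (measure_setOf_eq_zero_of_transitive)

variable {P : Params} {j : ℕ}

/-- The open `1∕2`-guard of loop families is where `E` IS the printed `exp[mean log]`; there `E` is continuous. [cite: Balaban1987RG1, (0.4) p.253] -/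
theorem continuousOn_extension (E : (Idx P → Matrix.specialUnitaryGroup (Fin 2) ℂ) → Matrix.specialUnitaryGroup (Fin 2) ℂ)
    (hE : ∀ W : Idx P → Matrix.specialUnitaryGroup (Fin 2) ℂ, (∀ i, ‖((W i : Matrix.specialUnitaryGroup (Fin 2) ℂ) : Matrix (Fin 2) (Fin 2) ℂ) - 1‖ < 1 / 2) →
      ((E W : Matrix.specialUnitaryGroup (Fin 2) ℂ) : Matrix (Fin 2) (Fin 2) ℂ) = eml (fun i => ((W i : Matrix.specialUnitaryGroup (Fin 2) ℂ) : Matrix (Fin 2) (Fin 2) ℂ))) :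
    ContinuousOn E {W | ∀ i, ‖((W i : Matrix.specialUnitaryGroup (Fin 2) ℂ) : Matrix (Fin 2) (Fin 2) ℂ) - 1‖ < 1 / 2} := by
  intro W₀ hW₀
  have hcoe : Continuous fun W : Idx P → Matrix.specialUnitaryGroup (Fin 2) ℂ => fun i => ((W i : Matrix.specialUnitaryGroup (Fin 2) ℂ) : Matrix (Fin 2) (Fin 2) ℂ) :=
    continuous_pi fun i => continuous_subtype_val.comp (continuous_apply i)
  have heml : ContinuousAt (eml : (Idx P → Matrix (Fin 2) (Fin 2) ℂ) → Matrix (Fin 2) (Fin 2) ℂ)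
      (fun i => ((W₀ i : Matrix.specialUnitaryGroup (Fin 2) ℂ) : Matrix (Fin 2) (Fin 2) ℂ)) :=
    (analyticAt_eml (𝔸 := Matrix (Fin 2) (Fin 2) ℂ) fun i => (hW₀ i).trans (by norm_num)).continuousAt
  have h1 : ContinuousWithinAt (fun W : Idx P → Matrix.specialUnitaryGroup (Fin 2) ℂ => eml fun i => ((W i : Matrix.specialUnitaryGroup (Fin 2) ℂ) : Matrix (Fin 2) (Fin 2) ℂ))
      {W | ∀ i, ‖((W i : Matrix.specialUnitaryGroup (Fin 2) ℂ) : Matrix (Fin 2) (Fin 2) ℂ) - 1‖ < 1 / 2} W₀ :=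
    (heml.comp hcoe.continuousAt).continuousWithinAt
  have h2 : ContinuousWithinAt (fun W => ((E W : Matrix.specialUnitaryGroup (Fin 2) ℂ) : Matrix (Fin 2) (Fin 2) ℂ))
      {W | ∀ i, ‖((W i : Matrix.specialUnitaryGroup (Fin 2) ℂ) : Matrix (Fin 2) (Fin 2) ℂ) - 1‖ < 1 / 2} W₀ :=
    h1.congr (fun W hW => hE W hW) (hE W₀ hW₀)
  exact (Topology.IsInducing.subtypeVal.continuousWithinAt_iff).2 h2

/-- `emb c₋ ≠ emb c₊` in the standing range (block centres of distinct coarse sites). [folklore] -/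
theorem emb_src_ne_emb_tgt (hj : j + 1 ≤ P.m + P.K) (c : PBond P (j + 1)) : emb c.src ≠ emb c.tgt := by
  intro h
  have h1 : c.src = c.tgt := by rw [← Site.blockOf_emb hj c.src, ← Site.blockOf_emb hj c.tgt, h]
  have h2 := congrFun h1 c.dir
  have h3 : (c.tgt : Site P (j + 1)) c.dir = c.src c.dir + 1 := by
    show (Site.shift c.src c.dir) c.dir = c.src c.dir + 1
    simp [Site.shift]
  rw [h3] at h2
  have h4 : c.src c.dir ≠ c.src c.dir + 1 := by
    haveI : Fact (1 < P.sitesPerDir (j + 1)) := ⟨P.one_lt_sitesPerDir (j + 1)⟩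
    simp
  exact h4 h2

/-- Under the ONE-SITE gauge transformation `u = (g at emb c₋, 1 elsewhere)` every open holonomy `V_i` of (0.4) at `c` is LEFT-multiplied by `g` (its walk starts at `emb c₋` and ends at
`emb c₊ ≠ emb c₋`). [cite: Balaban1985Averaging, (8) p.18] -/
theorem openHol_gaugeAct_update (hj : j + 1 ≤ P.m + P.K) (U : GaugeField P j (Matrix.specialUnitaryGroup (Fin 2) ℂ)) (c : PBond P (j + 1)) (i : Idx P)
    (g : Matrix.specialUnitaryGroup (Fin 2) ℂ) :
    openHol (GaugeField.gaugeAct (Function.update (fun _ => (1 : Matrix.specialUnitaryGroup (Fin 2) ℂ)) (emb c.src) g) U) c i = g * openHol U c i := by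
  classical
  unfold openHol
  rw [holAt_gaugeAct_walk, walkEnd_openWord, walkEnd_replicate_L]
  have htgt : emb (c.src.shift c.dir) = emb c.tgt := rfl
  rw [htgt, Function.update_self, Function.update_of_ne (emb_src_ne_emb_tgt hj c).symm, inv_one, mul_one]

/-- … hence the W-coordinate family transforms by CONJUGATION with `g` when the coarse variable is left-multiplied by `g`. [folklore] -/
theorem fibreFamily_gaugeAct_update (hj : j + 1 ≤ P.m + P.K) (U : GaugeField P j (Matrix.specialUnitaryGroup (Fin 2) ℂ)) (c : PBond P (j + 1))
    (g W : Matrix.specialUnitaryGroup (Fin 2) ℂ) (i : Idx P) :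
    fibreFamily (GaugeField.gaugeAct (Function.update (fun _ => (1 : Matrix.specialUnitaryGroup (Fin 2) ℂ)) (emb c.src) g) U) c (g * W) i =
      g * fibreFamily U c W i * g⁻¹ := by
  by_cases h : IsCentral c i
  · rw [fibreFamily_of_isCentral _ c _ i h, fibreFamily_of_isCentral _ c _ i h]; group
  · rw [fibreFamily_of_not_isCentral _ c _ i h, fibreFamily_of_not_isCentral _ c _ i h, openHol_gaugeAct_update hj, mul_inv_rev]; group

/-- On the `1∕2`-guard the extension `E` is conjugation-covariant (lit ✓`ExpMeanLog.eml_conj`). [cite: Balaban1987RG1, (0.6) p.253] -/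
theorem extension_conj (E : (Idx P → Matrix.specialUnitaryGroup (Fin 2) ℂ) → Matrix.specialUnitaryGroup (Fin 2) ℂ)
    (hE : ∀ W : Idx P → Matrix.specialUnitaryGroup (Fin 2) ℂ, (∀ i, ‖((W i : Matrix.specialUnitaryGroup (Fin 2) ℂ) : Matrix (Fin 2) (Fin 2) ℂ) - 1‖ < 1 / 2) →
      ((E W : Matrix.specialUnitaryGroup (Fin 2) ℂ) : Matrix (Fin 2) (Fin 2) ℂ) = eml (fun i => ((W i : Matrix.specialUnitaryGroup (Fin 2) ℂ) : Matrix (Fin 2) (Fin 2) ℂ)))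
    (F : Idx P → Matrix.specialUnitaryGroup (Fin 2) ℂ) (hF : ∀ i, dist1 (F i) < 1 / 2) (g : Matrix.specialUnitaryGroup (Fin 2) ℂ) :
    E (fun i => g * F i * g⁻¹) = g * E F * g⁻¹ := by
  have hF' : ∀ i, ‖((F i : Matrix.specialUnitaryGroup (Fin 2) ℂ) : Matrix (Fin 2) (Fin 2) ℂ) - 1‖ < 1 / 2 := hF
  have hgF : ∀ i, ‖(((g * F i * g⁻¹ : Matrix.specialUnitaryGroup (Fin 2) ℂ)) : Matrix (Fin 2) (Fin 2) ℂ) - 1‖ < 1 / 2 := by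
    intro i
    have h := GaugeGroup.dist1_conj (F i) g
    have h' : dist1 (g * F i * g⁻¹) < 1 / 2 := by rw [h]; exact hF i
    exact h'
  apply Subtype.ext
  have hvw : (g : Matrix (Fin 2) (Fin 2) ℂ) * ((g⁻¹ : Matrix.specialUnitaryGroup (Fin 2) ℂ) : Matrix (Fin 2) (Fin 2) ℂ) = 1 := by
    rw [← Submonoid.coe_mul, mul_inv_cancel]; rfl
  have hwv : ((g⁻¹ : Matrix.specialUnitaryGroup (Fin 2) ℂ) : Matrix (Fin 2) (Fin 2) ℂ) * (g : Matrix (Fin 2) (Fin 2) ℂ) = 1 := by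
    rw [← Submonoid.coe_mul, inv_mul_cancel]; rfl
  rw [hE _ hgF, Submonoid.coe_mul, Submonoid.coe_mul, hE _ hF']
  have hfam : (fun i => (((g * F i * g⁻¹ : Matrix.specialUnitaryGroup (Fin 2) ℂ)) : Matrix (Fin 2) (Fin 2) ℂ)) =
      fun i => (g : Matrix (Fin 2) (Fin 2) ℂ) * ((F i : Matrix.specialUnitaryGroup (Fin 2) ℂ) : Matrix (Fin 2) (Fin 2) ℂ) *
        ((g⁻¹ : Matrix.specialUnitaryGroup (Fin 2) ℂ) : Matrix (Fin 2) (Fin 2) ℂ) := by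
    funext i; rw [Submonoid.coe_mul, Submonoid.coe_mul]
  rw [hfam, eml_conj hvw hwv]

/-- ★★ **THE JOINT BOUNDARY GRAPH AT A CLOSED GUARD RADIUS `ρ < 1∕2` IS CLOSED** in `GaugeField × SU(2)`: it is the continuous image of the compact set
`{(U, W) | ∀ i, dist1 (fibreFamily U c W i) ≤ ρ ∧ ∃ i, dist1 (fibreFamily U c W i) = r}` under `(U, W) ↦ (U, E (fibreFamily U c W) · W)`. [folklore] -/
theorem isClosed_jointGraph (c : PBond P (j + 1)) (r : ℝ) {ρ : ℝ} (hρ : ρ < 1 / 2)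
    (E : (Idx P → Matrix.specialUnitaryGroup (Fin 2) ℂ) → Matrix.specialUnitaryGroup (Fin 2) ℂ)
    (hE : ∀ W : Idx P → Matrix.specialUnitaryGroup (Fin 2) ℂ, (∀ i, ‖((W i : Matrix.specialUnitaryGroup (Fin 2) ℂ) : Matrix (Fin 2) (Fin 2) ℂ) - 1‖ < 1 / 2) →
      ((E W : Matrix.specialUnitaryGroup (Fin 2) ℂ) : Matrix (Fin 2) (Fin 2) ℂ) = eml (fun i => ((W i : Matrix.specialUnitaryGroup (Fin 2) ℂ) : Matrix (Fin 2) (Fin 2) ℂ))) :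
    IsClosed {p : GaugeField P j (Matrix.specialUnitaryGroup (Fin 2) ℂ) × Matrix.specialUnitaryGroup (Fin 2) ℂ |
      ∃ W : Matrix.specialUnitaryGroup (Fin 2) ℂ, (∀ i, dist1 (fibreFamily p.1 c W i) ≤ ρ) ∧ (∃ i, dist1 (fibreFamily p.1 c W i) = r) ∧
        E (fibreFamily p.1 c W) * W = p.2} := by
  classical
  haveI : CompactSpace (GaugeField P j (Matrix.specialUnitaryGroup (Fin 2) ℂ)) :=
    inferInstanceAs (CompactSpace (PBond P j → Matrix.specialUnitaryGroup (Fin 2) ℂ))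
  haveI : T2Space (GaugeField P j (Matrix.specialUnitaryGroup (Fin 2) ℂ)) :=
    inferInstanceAs (T2Space (PBond P j → Matrix.specialUnitaryGroup (Fin 2) ℂ))
  -- the source set and the map
  set T : Set (GaugeField P j (Matrix.specialUnitaryGroup (Fin 2) ℂ) × Matrix.specialUnitaryGroup (Fin 2) ℂ) :=
    {x | (∀ i, dist1 (fibreFamily x.1 c x.2 i) ≤ ρ) ∧ ∃ i, dist1 (fibreFamily x.1 c x.2 i) = r} with hT
  set Φ : GaugeField P j (Matrix.specialUnitaryGroup (Fin 2) ℂ) × Matrix.specialUnitaryGroup (Fin 2) ℂ →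
      GaugeField P j (Matrix.specialUnitaryGroup (Fin 2) ℂ) × Matrix.specialUnitaryGroup (Fin 2) ℂ := fun x => (x.1, E (fibreFamily x.1 c x.2) * x.2) with hΦ
  have hd : ∀ i, Continuous fun x : GaugeField P j (Matrix.specialUnitaryGroup (Fin 2) ℂ) × Matrix.specialUnitaryGroup (Fin 2) ℂ => dist1 (fibreFamily x.1 c x.2 i) :=
    fun i => B12ContinuousTransportInvarianceOn.continuous_dist1_SU.comp (continuous_fibreFamily_uncurry c i)
  have hTc : IsClosed T := by
    have h1 : IsClosed {x : GaugeField P j (Matrix.specialUnitaryGroup (Fin 2) ℂ) × Matrix.specialUnitaryGroup (Fin 2) ℂ |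
        ∀ i, dist1 (fibreFamily x.1 c x.2 i) ≤ ρ} := by
      rw [Set.setOf_forall]; exact isClosed_iInter fun i => isClosed_le (hd i) continuous_const
    have h2 : IsClosed {x : GaugeField P j (Matrix.specialUnitaryGroup (Fin 2) ℂ) × Matrix.specialUnitaryGroup (Fin 2) ℂ |
        ∃ i, dist1 (fibreFamily x.1 c x.2 i) = r} := by
      rw [Set.setOf_exists]; exact isClosed_iUnion_of_finite fun i => isClosed_eq (hd i) continuous_const
    rw [hT, Set.setOf_and]; exact h1.inter h2
  have hTk : IsCompact T := hTc.isCompact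
  -- `Φ` is continuous on the open guard, which contains `T`
  have hfamc : Continuous fun x : GaugeField P j (Matrix.specialUnitaryGroup (Fin 2) ℂ) × Matrix.specialUnitaryGroup (Fin 2) ℂ => fibreFamily x.1 c x.2 :=
    continuous_pi fun i => continuous_fibreFamily_uncurry c i
  have hmaps : Set.MapsTo (fun x : GaugeField P j (Matrix.specialUnitaryGroup (Fin 2) ℂ) × Matrix.specialUnitaryGroup (Fin 2) ℂ => fibreFamily x.1 c x.2) T
      {W | ∀ i, ‖((W i : Matrix.specialUnitaryGroup (Fin 2) ℂ) : Matrix (Fin 2) (Fin 2) ℂ) - 1‖ < 1 / 2} := by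
    intro x hx i
    show dist1 (fibreFamily x.1 c x.2 i) < 1 / 2
    exact (hx.1 i).trans_lt hρ
  have hEc : ContinuousOn (fun x : GaugeField P j (Matrix.specialUnitaryGroup (Fin 2) ℂ) × Matrix.specialUnitaryGroup (Fin 2) ℂ => E (fibreFamily x.1 c x.2)) T :=
    (continuousOn_extension E hE).comp hfamc.continuousOn hmaps
  have hΦc : ContinuousOn Φ T := continuousOn_fst.prodMk (hEc.mul continuousOn_snd)
  have himg : IsClosed (Φ '' T) := (hTk.image_of_continuousOn hΦc).isClosed
  -- the image is the joint graph
  have heq : Φ '' T = {p : GaugeField P j (Matrix.specialUnitaryGroup (Fin 2) ℂ) × Matrix.specialUnitaryGroup (Fin 2) ℂ |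
      ∃ W : Matrix.specialUnitaryGroup (Fin 2) ℂ, (∀ i, dist1 (fibreFamily p.1 c W i) ≤ ρ) ∧ (∃ i, dist1 (fibreFamily p.1 c W i) = r) ∧
        E (fibreFamily p.1 c W) * W = p.2} := by
    ext p
    constructor
    · rintro ⟨x, hx, rfl⟩
      exact ⟨x.2, hx.1, hx.2, rfl⟩
    · rintro ⟨W, h1, h2, h3⟩
      refine ⟨(p.1, W), ⟨h1, h2⟩, ?_⟩
      show (p.1, E (fibreFamily p.1 c W) * W) = p
      rw [h3]
  rw [← heq]; exact himg

/-- ★★★ **THE EML-BRANCH BOUNDARY SLICE IS `dU`-NULL AT EVERY COARSE VALUE, CLOSED-RADIUS FORM**: for `ρ < 1∕2`, `r ≠ 0`, every `v ∈ SU(2)`,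
`dU {U | ∃ W, (∀ i, dist1 (fibreFamily U c W i) ≤ ρ) ∧ (∃ i, dist1 (fibreFamily U c W i) = r) ∧ E (fibreFamily U c W) · W = v} = 0` — ENDPOINT-GAUGE TRANSITIVITY
(✓p823727): the graph is closed (measurable), every vertical slice is Haar-null (§2), the one-site gauge transformations at `emb c₋` preserve `dU`, stabilise the graph and act
transitively `v ↦ g · v` on `SU(2)`. [cite: Balaban1987RG1, (0.4) p.253] -/
theorem fieldMeasure_setOf_exists_boundary_preimage_eq_zero_of_le (hj : j + 1 ≤ P.m + P.K) (c : PBond P (j + 1)) {r : ℝ} (hr : r ≠ 0) {ρ : ℝ} (hρ : ρ < 1 / 2)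
    (E : (Idx P → Matrix.specialUnitaryGroup (Fin 2) ℂ) → Matrix.specialUnitaryGroup (Fin 2) ℂ)
    (hE : ∀ W : Idx P → Matrix.specialUnitaryGroup (Fin 2) ℂ, (∀ i, ‖((W i : Matrix.specialUnitaryGroup (Fin 2) ℂ) : Matrix (Fin 2) (Fin 2) ℂ) - 1‖ < 1 / 2) →
      ((E W : Matrix.specialUnitaryGroup (Fin 2) ℂ) : Matrix (Fin 2) (Fin 2) ℂ) = eml (fun i => ((W i : Matrix.specialUnitaryGroup (Fin 2) ℂ) : Matrix (Fin 2) (Fin 2) ℂ)))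
    (v : Matrix.specialUnitaryGroup (Fin 2) ℂ) :
    fieldMeasure P j (Matrix.specialUnitaryGroup (Fin 2) ℂ)
      {U | ∃ W : Matrix.specialUnitaryGroup (Fin 2) ℂ, (∀ i, dist1 (fibreFamily U c W i) ≤ ρ) ∧ (∃ i, dist1 (fibreFamily U c W i) = r) ∧
        E (fibreFamily U c W) * W = v} = 0 := by
  classical
  haveI := Literature.MathematicalPhysics.QuantumLattice.secondCountableTopology_su2
  haveI : SecondCountableTopology (GaugeField P j (Matrix.specialUnitaryGroup (Fin 2) ℂ)) :=
    inferInstanceAs (SecondCountableTopology (PBond P j → Matrix.specialUnitaryGroup (Fin 2) ℂ))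
  haveI : BorelSpace (GaugeField P j (Matrix.specialUnitaryGroup (Fin 2) ℂ)) :=
    inferInstanceAs (BorelSpace (PBond P j → Matrix.specialUnitaryGroup (Fin 2) ℂ))
  haveI : IsProbabilityMeasure (HaarData.haar : Measure (Matrix.specialUnitaryGroup (Fin 2) ℂ)) := HaarData.isProb
  haveI : IsProbabilityMeasure (fieldMeasure P j (Matrix.specialUnitaryGroup (Fin 2) ℂ)) := Missing.isProbabilityMeasure_fieldMeasure P j
  -- the relation and its measurable graph
  let R : GaugeField P j (Matrix.specialUnitaryGroup (Fin 2) ℂ) → Matrix.specialUnitaryGroup (Fin 2) ℂ → Prop := fun U v =>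
    ∃ W : Matrix.specialUnitaryGroup (Fin 2) ℂ, (∀ i, dist1 (fibreFamily U c W i) ≤ ρ) ∧ (∃ i, dist1 (fibreFamily U c W i) = r) ∧ E (fibreFamily U c W) * W = v
  have hR : MeasurableSet {p : GaugeField P j (Matrix.specialUnitaryGroup (Fin 2) ℂ) × Matrix.specialUnitaryGroup (Fin 2) ℂ | R p.1 p.2} :=
    (isClosed_jointGraph c r hρ E hE).measurableSet
  -- vertical slices are Haar-null (§2)
  have hv : ∀ U, (HaarData.haar : Measure (Matrix.specialUnitaryGroup (Fin 2) ℂ)) {v | R U v} = 0 := by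
    intro U
    refine haar_null_of_subset_image_boundarySet U c hr E hE (measurable_prodMk_left hR) ?_
    rintro w ⟨W, h1, h2, h3⟩
    exact ⟨W, ⟨fun i => (h1 i).trans_lt hρ, h2⟩, h3⟩
  -- one-site gauge transformations: measure-preserving, stabilising, transitive
  let u : Matrix.specialUnitaryGroup (Fin 2) ℂ → GaugeTransf P j (Matrix.specialUnitaryGroup (Fin 2) ℂ) := fun g =>
    Function.update (fun _ => (1 : Matrix.specialUnitaryGroup (Fin 2) ℂ)) (emb c.src) g
  have hφ : ∀ g, MeasurePreserving (GaugeField.gaugeAct (u g)) (fieldMeasure P j (Matrix.specialUnitaryGroup (Fin 2) ℂ))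
      (fieldMeasure P j (Matrix.specialUnitaryGroup (Fin 2) ℂ)) := fun g => B12RTGaugeInvariance254.measurePreserving_gaugeAct (u g)
  have hst : ∀ g U w, R U w → R (GaugeField.gaugeAct (u g) U) (g * w) := by
    rintro g U w ⟨W, h1, h2, h3⟩
    refine ⟨g * W, fun i => ?_, ?_, ?_⟩
    · rw [fibreFamily_gaugeAct_update hj, GaugeGroup.dist1_conj]; exact h1 i
    · obtain ⟨i, hi⟩ := h2
      exact ⟨i, by rw [fibreFamily_gaugeAct_update hj, GaugeGroup.dist1_conj]; exact hi⟩
    · have hfam : fibreFamily (GaugeField.gaugeAct (u g) U) c (g * W) = fun i => g * fibreFamily U c W i * g⁻¹ :=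
        funext fun i => fibreFamily_gaugeAct_update hj U c g W i
      have hF : ∀ i, dist1 (fibreFamily U c W i) < 1 / 2 := fun i => (h1 i).trans_lt hρ
      rw [hfam, extension_conj E hE _ hF g, ← h3]; group
  have htrans : ∀ a b : Matrix.specialUnitaryGroup (Fin 2) ℂ, ∃ g : Matrix.specialUnitaryGroup (Fin 2) ℂ, g * a = b :=
    fun a b => ⟨b * a⁻¹, by group⟩
  have hν : (HaarData.haar : Measure (Matrix.specialUnitaryGroup (Fin 2) ℂ)) ≠ 0 := IsProbabilityMeasure.ne_zero _
  exact measure_setOf_eq_zero_of_transitive (fieldMeasure P j (Matrix.specialUnitaryGroup (Fin 2) ℂ)) HaarData.haar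
    (R := R) hR hv (φ := fun g => GaugeField.gaugeAct (u g)) (ψ := fun g w => g * w) hφ hst htrans hν v

end Joint

/-! ## §4 (F4-b): the open `1∕2`-guard form, by exhaustion with closed radii -/

section Main

open Literature.MathematicalPhysics.QuantumFieldTheory.Balaban1983to89
open T4Continuum BlockAveraging BlockAveragingHaarAC BlockAveragingEMLHaarAC
open ExpMeanLog (eml deltaSU deltaSU_pos)

variable {P : Params} {j : ℕ}

/-- ★★★ **(F4-b) THE EML-BRANCH PER-DATUM NULL SET** (px17 g21's interface, 13:14:32Z): for every coarse bond `c`, every radius `r ≠ 0`, ANY extension `E` of the printed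
`exp[mean log]` off the `1∕2`-guard, and EVERY coarse value `v ∈ SU(2)`, the set of environments `U` admitting a private coordinate `W` with the W-family INSIDE the
`1∕2`-guard, ON the `r`-sphere at some index, and guarded fibre value `E (fibreFamily U c W) · W = v` is `dU`-null — for EVERY `v`, not merely Haar-a.e.  (Countable union over
the closed radii `ρ_n = 1∕2 − 1∕(n+1)` of §3: finitely many indices put every guard-interior family inside some `ρ_n`.)  No transversality, no injectivity, no smallness;
uniform in `L`. [cite: Balaban1987RG1, (0.4) p.253] -/
theorem fieldMeasure_setOf_exists_boundary_preimage_eq_zero (hj : j + 1 ≤ P.m + P.K) (c : PBond P (j + 1)) {r : ℝ} (hr : r ≠ 0)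
    (E : (Idx P → Matrix.specialUnitaryGroup (Fin 2) ℂ) → Matrix.specialUnitaryGroup (Fin 2) ℂ)
    (hE : ∀ W : Idx P → Matrix.specialUnitaryGroup (Fin 2) ℂ, (∀ i, ‖((W i : Matrix.specialUnitaryGroup (Fin 2) ℂ) : Matrix (Fin 2) (Fin 2) ℂ) - 1‖ < 1 / 2) →
      ((E W : Matrix.specialUnitaryGroup (Fin 2) ℂ) : Matrix (Fin 2) (Fin 2) ℂ) = eml (fun i => ((W i : Matrix.specialUnitaryGroup (Fin 2) ℂ) : Matrix (Fin 2) (Fin 2) ℂ)))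
    (v : Matrix.specialUnitaryGroup (Fin 2) ℂ) :
    fieldMeasure P j (Matrix.specialUnitaryGroup (Fin 2) ℂ)
      {U | ∃ W : Matrix.specialUnitaryGroup (Fin 2) ℂ, (∀ i, dist1 (fibreFamily U c W i) < 1 / 2) ∧ (∃ i, dist1 (fibreFamily U c W i) = r) ∧
        E (fibreFamily U c W) * W = v} = 0 := by
  classical
  set ρ : ℕ → ℝ := fun n => 1 / 2 - 1 / ((n : ℝ) + 1) with hρ
  have hρlt : ∀ n, ρ n < 1 / 2 := fun n => by
    have : (0 : ℝ) < 1 / ((n : ℝ) + 1) := by positivity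
    simp only [hρ]; linarith
  have hsub : {U : GaugeField P j (Matrix.specialUnitaryGroup (Fin 2) ℂ) | ∃ W : Matrix.specialUnitaryGroup (Fin 2) ℂ,
      (∀ i, dist1 (fibreFamily U c W i) < 1 / 2) ∧ (∃ i, dist1 (fibreFamily U c W i) = r) ∧ E (fibreFamily U c W) * W = v} ⊆
      ⋃ n : ℕ, {U | ∃ W : Matrix.specialUnitaryGroup (Fin 2) ℂ, (∀ i, dist1 (fibreFamily U c W i) ≤ ρ n) ∧ (∃ i, dist1 (fibreFamily U c W i) = r) ∧
        E (fibreFamily U c W) * W = v} := by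
    rintro U ⟨W, h1, h2, h3⟩
    -- a uniform margin below `1∕2` over the finitely many indices
    obtain ⟨n, hn⟩ : ∃ n : ℕ, ∀ i, dist1 (fibreFamily U c W i) ≤ ρ n := by
      rcases isEmpty_or_nonempty (Idx P) with hI | hI
      · exact ⟨0, fun i => (IsEmpty.false i).elim⟩
      · obtain ⟨i₀, hi₀⟩ := Finite.exists_max fun i => dist1 (fibreFamily U c W i)
        have hgap : 0 < 1 / 2 - dist1 (fibreFamily U c W i₀) := sub_pos.2 (h1 i₀)
        obtain ⟨n, hn⟩ := exists_nat_one_div_lt hgap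
        exact ⟨n, fun i => by have := hi₀ i; simp only [hρ]; linarith⟩
    exact Set.mem_iUnion.2 ⟨n, W, hn, h2, h3⟩
  exact measure_mono_null hsub ((measure_iUnion_null_iff).2 fun n =>
    fieldMeasure_setOf_exists_boundary_preimage_eq_zero_of_le hj c hr (hρlt n) E hE v)

/-- ★★ The same at the printed guard radius `r = δ_{SU(2)} = min(1∕3, π∕2)` of lit ✓`ExpMeanLog.expMeanLogSU` (the letter (F5) `obtain`s). [cite: Balaban1987RG1, (0.4) p.253] -/
theorem fieldMeasure_setOf_exists_boundary_preimage_eq_zero_deltaSU (hj : j + 1 ≤ P.m + P.K) (c : PBond P (j + 1))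
    (E : (Idx P → Matrix.specialUnitaryGroup (Fin 2) ℂ) → Matrix.specialUnitaryGroup (Fin 2) ℂ)
    (hE : ∀ W : Idx P → Matrix.specialUnitaryGroup (Fin 2) ℂ, (∀ i, ‖((W i : Matrix.specialUnitaryGroup (Fin 2) ℂ) : Matrix (Fin 2) (Fin 2) ℂ) - 1‖ < 1 / 2) →
      ((E W : Matrix.specialUnitaryGroup (Fin 2) ℂ) : Matrix (Fin 2) (Fin 2) ℂ) = eml (fun i => ((W i : Matrix.specialUnitaryGroup (Fin 2) ℂ) : Matrix (Fin 2) (Fin 2) ℂ)))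
    (v : Matrix.specialUnitaryGroup (Fin 2) ℂ) :
    fieldMeasure P j (Matrix.specialUnitaryGroup (Fin 2) ℂ)
      {U | ∃ W : Matrix.specialUnitaryGroup (Fin 2) ℂ, (∀ i, dist1 (fibreFamily U c W i) < 1 / 2) ∧ (∃ i, dist1 (fibreFamily U c W i) = deltaSU (Fin 2)) ∧
        E (fibreFamily U c W) * W = v} = 0 :=
  fieldMeasure_setOf_exists_boundary_preimage_eq_zero hj c (deltaSU_pos (n := Fin 2)).ne' E hE v

end Main

end Summit.QuantumFields.YangMills.Theorems.FluctuationComparisonRegPrIntLS1aEMLBoundarySliceNull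

end
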